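import Mathlib.Probability.Kernel.MeasurableLIntegral
import Mathlib.Probability.Kernel.Composition.MapComap
import Mathlib.MeasureTheory.Function.Floor
import Mathlib.MeasureTheory.Constructions.BorelSpace.Metric
import Mathlib.MeasureTheory.Group.MeasurableEquiv
import Mathlib.Analysis.Normed.Group.Basic
import Literature.Probability.Process.PointStationaryTransfer

/-!
# Bond random walk transport for point-stationary laws (root-degree-regular case)

Support lemma «SymmetricBondWalkTransport» for the lens-3 lines on
`ChartedPlanarOrder.ChartedZeroExcessLayered` (V-line `stub_walkTransport`, C-prep `Tc`):
for a law `P` of rooted configurations `μ : Measure E` satisfying the Mecke / mass-transport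
identity (`IsPointStationaryLaw P`), carried by locally finite configurations, and such that the
ROOT has a.s. exactly `d` neighbours in a symmetric measurable bond set `B` (`μ B = d`), the law
`P` is stationary for the re-rooting along one step of the simple random walk on the bond graph:
for every measurable `F : Measure E → ℝ≥0∞` and every `n`,

  `∫⁻ μ, (W_μ^n (y ↦ F (θ_y μ))) 0 ∂P = ∫⁻ μ, F μ ∂P`,   `(W_μ h)(x) = d⁻¹ ∫⁻ y, 1_B (y - x) h y ∂μ`

(`lintegral_confWalk_iterate`). This is the point-process form of the Aldous–Lyons stationarity of
the simple random walk on unimodular `d`-regular rooted graphs [AldousLyons2007, §4, Thm 4.1];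
only the ROOT degree is needed (everything else shows at the root).

* `iterate_rootWalkStep_map_sub` — covariance `(step^n F)(θ_x μ) = (W_μ^n f)(x)` (no hypotheses;
  the walk operators are written out as lambdas, see below).
* `lintegral_rootWalkStepK` — one-step invariance (Mecke with `g (ν, y) = 1_B y · G (θ_y ν)`),
  made measurable through the s-finite kernel device `exists_isSFiniteKernel_apply_eq_self` and
  `measurable_map_sub_kernel` of `PointStationaryTransfer.lean`.
* `lintegral_confWalk_iterate` — the `n`-step transport identity.

## References
* D. Aldous, R. Lyons, *Processes on unimodular random networks*, EJP 12 (2007), §4. [AldousLyons2007]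
* G. Last, H. Thorisson, *Invariant transports of stationary random measures and
  mass-stationarity*, Ann. Probab. 37 (2009). [LastThorisson2009]
-/

noncomputable section

open scoped ENNReal
open MeasureTheory MeasureTheory.Measure ProbabilityTheory Set Filter
open Literature.Probability.Process

namespace Summit.AtomisticToContinuum.Crystallization.Theorems.ChartedPlanarOrderBondWalkTransport

variable {E : Type*} [NormedAddCommGroup E] [MeasurableSpace E] [BorelSpace E]

/-! ### Locally finite configurations: bounded sets and translates -/

omit [BorelSpace E] in
/-- A configuration with finite mass on every norm shell gives finite mass to every closed ball
about the origin. [folklore] -/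
theorem measure_closedBall_lt_top_of_shells {μ : Measure E}
    (hμ : ∀ n : ℕ, μ ((fun z : E => ⌊‖z‖⌋₊) ⁻¹' {n}) < ∞) (r : ℝ) :
    μ (Metric.closedBall (0 : E) r) < ∞ := by
  have hsub : Metric.closedBall (0 : E) r ⊆
      ⋃ n ∈ Finset.range (⌊r⌋₊ + 1), (fun z : E => ⌊‖z‖⌋₊) ⁻¹' {n} := by
    intro z hz
    have hz' : ‖z‖ ≤ r := mem_closedBall_zero_iff.1 hz
    exact Set.mem_iUnion₂.2 ⟨⌊‖z‖⌋₊, Finset.mem_range.2 (Nat.lt_succ_of_le (Nat.floor_mono hz')), rfl⟩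
  refine (measure_mono hsub).trans_lt ((measure_biUnion_finset_le _ _).trans_lt ?_)
  exact ENNReal.sum_lt_top.2 fun n _ => hμ n

/-- Re-rooting a locally finite configuration at any point keeps it locally finite. [folklore] -/
theorem shells_map_sub_lt_top {μ : Measure E}
    (hμ : ∀ n : ℕ, μ ((fun z : E => ⌊‖z‖⌋₊) ⁻¹' {n}) < ∞) (y : E) (n : ℕ) :
    (Measure.map (fun z => z - y) μ) ((fun z : E => ⌊‖z‖⌋₊) ⁻¹' {n}) < ∞ := by
  rw [Measure.map_apply (measurable_sub_const y) (measurableSet_floorNorm_preimage n)]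
  have hsub : (fun z => z - y) ⁻¹' ((fun z : E => ⌊‖z‖⌋₊) ⁻¹' {n}) ⊆
      Metric.closedBall (0 : E) (‖y‖ + ((n : ℝ) + 1)) := by
    intro z hz
    have h1 : z - y ∈ Metric.closedBall (0 : E) ((n : ℝ) + 1) :=
      floorNorm_preimage_subset_closedBall n hz
    rw [mem_closedBall_zero_iff] at h1 ⊢
    calc ‖z‖ = ‖(z - y) + y‖ := by rw [sub_add_cancel]
      _ ≤ ‖z - y‖ + ‖y‖ := norm_add_le _ _
      _ ≤ ‖y‖ + ((n : ℝ) + 1) := by linarith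
  exact (measure_mono hsub).trans_lt (measure_closedBall_lt_top_of_shells hμ _)

/-- Composition of two re-rootings. [folklore] -/
theorem map_sub_map_sub (μ : Measure E) (x y : E) :
    Measure.map (fun z => z - y) (Measure.map (fun z => z - x) μ)
      = Measure.map (fun z => z - (x + y)) μ := by
  rw [Measure.map_map (measurable_sub_const y) (measurable_sub_const x)]
  congr 1
  funext z
  simp only [Function.comp_apply]
  abel

omit [BorelSpace E] in
/-- Re-rooting at the origin is the identity. [folklore] -/
theorem map_sub_zero' (μ : Measure E) : Measure.map (fun z => z - (0 : E)) μ = μ := by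
  have : (fun z : E => z - 0) = id := funext fun z => sub_zero z
  rw [this, Measure.map_id]

/-! ### The walk step: on root functionals and on a fixed configuration -/

/-! In the statements below the three walk operators are written out as lambdas:
* root-functional step   `stepᴮ_c G = fun ν => c * ∫⁻ y, 1_B y · G (θ_y ν) ∂ν`,
* its kernel version      `stepᴮ_c^κ G = fun ν => c * ∫⁻ y, 1_B y · G (θ_y (κ ν)) ∂(κ ν)`,
* configuration step      `W_μ h = fun x => c * ∫⁻ y, 1_B (y - x) · h y ∂μ`. -/

variable [SecondCountableTopology E]

omit [SecondCountableTopology E] in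
/-- COVARIANCE: the `n`-fold root-functional walk evaluated at the configuration re-rooted at `x`
is the `n`-fold configuration walk of `y ↦ F (θ_y μ)` evaluated at `x`. No hypotheses. -/
theorem iterate_rootWalkStep_map_sub (B : Set E) (c : ℝ≥0∞) (F : Measure E → ℝ≥0∞)
    (μ : Measure E) : ∀ (n : ℕ) (x : E),
    ((fun (G : Measure E → ℝ≥0∞) (ν : Measure E) =>
      c * ∫⁻ y, B.indicator (fun y => G (Measure.map (fun z => z - y) ν)) y ∂ν)^[n] F) (Measure.map (fun z => z - x) μ)
      = ((fun (h : E → ℝ≥0∞) (x : E) => c * ∫⁻ y, ((fun y => y - x) ⁻¹' B).indicator h y ∂μ)^[n] (fun y => F (Measure.map (fun z => z - y) μ))) x := by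
  intro n
  induction n with
  | zero => intro x; rfl
  | succ n ih =>
    intro x
    rw [Function.iterate_succ_apply', Function.iterate_succ_apply']
    congr 1
    have hme : (fun z : E => z - x) = ⇑(MeasurableEquiv.subRight x) := by
      funext z; simp [MeasurableEquiv.subRight]
    rw [hme, lintegral_map_equiv]
    refine lintegral_congr fun y => ?_
    rw [← hme]
    beta_reduce
    by_cases hy : y - x ∈ B
    · have hy' : y ∈ (fun y => y - x) ⁻¹' B := hy
      simp only [Set.indicator_of_mem hy, Set.indicator_of_mem hy']
      rw [map_sub_map_sub, add_sub_cancel, ih]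
    · have hy' : y ∉ (fun y => y - x) ⁻¹' B := hy
      simp only [Set.indicator_of_notMem hy, Set.indicator_of_notMem hy']

omit [SecondCountableTopology E] in
/-- At the root: `(step^n F)(μ) = (W_μ^n (y ↦ F (θ_y μ)))(0)`. -/
theorem iterate_rootWalkStep_eq_confWalk (B : Set E) (c : ℝ≥0∞) (F : Measure E → ℝ≥0∞)
    (μ : Measure E) (n : ℕ) :
    ((fun (G : Measure E → ℝ≥0∞) (ν : Measure E) =>
      c * ∫⁻ y, B.indicator (fun y => G (Measure.map (fun z => z - y) ν)) y ∂ν)^[n] F) μ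
      = ((fun (h : E → ℝ≥0∞) (x : E) => c * ∫⁻ y, ((fun y => y - x) ⁻¹' B).indicator h y ∂μ)^[n] (fun y => F (Measure.map (fun z => z - y) μ))) 0 := by
  rw [← iterate_rootWalkStep_map_sub B c F μ n 0, map_sub_zero']

/-- The kernel version is measurable (kernel measurability API of Mathlib + joint measurability of
re-rooting, `measurable_map_sub_kernel`). -/
theorem measurable_rootWalkStepK (κ : Kernel (Measure E) E) [IsSFiniteKernel κ] {B : Set E}
    (hBm : MeasurableSet B) (c : ℝ≥0∞) {G : Measure E → ℝ≥0∞} (hG : Measurable G) :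
    Measurable ((fun (G : Measure E → ℝ≥0∞) (ν : Measure E) =>
      c * ∫⁻ y, B.indicator (fun y => G (Measure.map (fun z => z - y) (κ ν))) y ∂(κ ν)) G) := by
  have h1 : Measurable fun p : Measure E × E => G (Measure.map (fun z => z - p.2) (κ p.1)) :=
    hG.comp (measurable_map_sub_kernel κ)
  have h2 : (Function.uncurry fun (ν : Measure E) (y : E) =>
      B.indicator (fun y => G (Measure.map (fun z => z - y) (κ ν))) y)
      = (Prod.snd ⁻¹' B).indicator
          (fun p : Measure E × E => G (Measure.map (fun z => z - p.2) (κ p.1))) := by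
    funext p
    rcases p with ⟨ν, y⟩
    rfl
  have h : Measurable (Function.uncurry fun (ν : Measure E) (y : E) =>
      B.indicator (fun y => G (Measure.map (fun z => z - y) (κ ν))) y) := by
    rw [h2]; exact h1.indicator (measurable_snd hBm)
  exact (h.lintegral_kernel_prod_right).const_mul c

omit [SecondCountableTopology E] in
/-- Kernel version and true version of the iterated walk agree on locally finite configurations
(where `κ` is the identity). -/
theorem iterate_rootWalkStepK_eq (κ : Kernel (Measure E) E)
    (hκid : ∀ μ : Measure E, (∀ n : ℕ, μ ((fun z : E => ⌊‖z‖⌋₊) ⁻¹' {n}) < ∞) → κ μ = μ)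
    (B : Set E) (c : ℝ≥0∞) (G : Measure E → ℝ≥0∞) : ∀ (n : ℕ) (ν : Measure E),
    (∀ k : ℕ, ν ((fun z : E => ⌊‖z‖⌋₊) ⁻¹' {k}) < ∞) →
      ((fun (G : Measure E → ℝ≥0∞) (ν : Measure E) =>
      c * ∫⁻ y, B.indicator (fun y => G (Measure.map (fun z => z - y) (κ ν))) y ∂(κ ν))^[n] G) ν = ((fun (G : Measure E → ℝ≥0∞) (ν : Measure E) =>
      c * ∫⁻ y, B.indicator (fun y => G (Measure.map (fun z => z - y) ν)) y ∂ν)^[n] G) ν := by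
  intro n
  induction n with
  | zero => intro ν _; rfl
  | succ n ih =>
    intro ν hν
    rw [Function.iterate_succ_apply', Function.iterate_succ_apply', hκid ν hν]
    congr 1
    refine lintegral_congr fun y => ?_
    by_cases hy : y ∈ B
    · simp only [Set.indicator_of_mem hy]
      exact ih _ (shells_map_sub_lt_top hν y)
    · simp only [Set.indicator_of_notMem hy]

/-! ### Invariance of the law under one walk step, and under `n` steps -/

/-- ONE-STEP TRANSPORT (Mecke with `g (ν, y) = 1_B y · G (θ_y (κ ν))`): if the root has a.s.
exactly `d` bond-neighbours (`μ B = d`, `B` symmetric), then `∫⁻ step_{d⁻¹} G ∂P = ∫⁻ G ∂P`.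
[AldousLyons2007, Thm 4.1, point-process form] -/
theorem lintegral_rootWalkStepK {P : Measure (Measure E)} (hP : IsPointStationaryLaw P)
    (hlf : ∀ᵐ μ ∂P, ∀ n : ℕ, μ ((fun z : E => ⌊‖z‖⌋₊) ⁻¹' {n}) < ∞)
    (κ : Kernel (Measure E) E) [IsSFiniteKernel κ]
    (hκid : ∀ μ : Measure E, (∀ n : ℕ, μ ((fun z : E => ⌊‖z‖⌋₊) ⁻¹' {n}) < ∞) → κ μ = μ)
    {B : Set E} (hBm : MeasurableSet B) (hBsymm : ∀ y : E, -y ∈ B ↔ y ∈ B)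
    {d : ℝ≥0∞} (hd0 : d ≠ 0) (hdtop : d ≠ ⊤) (hdeg : ∀ᵐ μ ∂P, μ B = d)
    {G : Measure E → ℝ≥0∞} (hG : Measurable G) :
    ∫⁻ μ, (fun (G : Measure E → ℝ≥0∞) (ν : Measure E) =>
      d⁻¹ * ∫⁻ y, B.indicator (fun y => G (Measure.map (fun z => z - y) (κ ν))) y ∂(κ ν)) G μ ∂P = ∫⁻ μ, G μ ∂P := by
  set g : Measure E → E → ℝ≥0∞ :=
    fun ν y => B.indicator (fun y => G (Measure.map (fun z => z - y) (κ ν))) y with hg_def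
  have hg : Measurable (Function.uncurry g) := by
    have h1 : Measurable fun p : Measure E × E => G (Measure.map (fun z => z - p.2) (κ p.1)) :=
      hG.comp (measurable_map_sub_kernel κ)
    have h2 : Function.uncurry g = (Prod.snd ⁻¹' B).indicator
        (fun p : Measure E × E => G (Measure.map (fun z => z - p.2) (κ p.1))) := by
      funext p
      rcases p with ⟨ν, y⟩
      rfl
    rw [h2]; exact h1.indicator (measurable_snd hBm)
  have hstep : ∀ μ : Measure E, (fun (G : Measure E → ℝ≥0∞) (ν : Measure E) =>
      d⁻¹ * ∫⁻ y, B.indicator (fun y => G (Measure.map (fun z => z - y) (κ ν))) y ∂(κ ν)) G μ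
      = d⁻¹ * ∫⁻ y, g μ y ∂(κ μ) := fun μ => rfl
  -- received mass at locally finite `μ`: `∫⁻ y, g (θ_y μ) (-y) ∂μ = G μ * μ B`
  have hrec : ∀ μ : Measure E, (∀ n : ℕ, μ ((fun z : E => ⌊‖z‖⌋₊) ⁻¹' {n}) < ∞) →
      ∫⁻ y, g (Measure.map (fun z => z - y) μ) (-y) ∂μ = G μ * μ B := by
    intro μ hμ
    have hpt : ∀ y : E, g (Measure.map (fun z => z - y) μ) (-y) = B.indicator (fun _ => G μ) y := by
      intro y
      by_cases hy : y ∈ B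
      · have hny : -y ∈ B := (hBsymm y).2 hy
        simp only [hg_def, Set.indicator_of_mem hny, Set.indicator_of_mem hy]
        rw [hκid _ (shells_map_sub_lt_top hμ y), map_sub_map_sub, add_neg_cancel, map_sub_zero']
      · have hny : -y ∉ B := fun h => hy ((hBsymm y).1 h)
        simp only [hg_def, Set.indicator_of_notMem hny, Set.indicator_of_notMem hy]
    rw [lintegral_congr hpt, lintegral_indicator_const hBm]
  calc ∫⁻ μ, (fun (G : Measure E → ℝ≥0∞) (ν : Measure E) =>
      d⁻¹ * ∫⁻ y, B.indicator (fun y => G (Measure.map (fun z => z - y) (κ ν))) y ∂(κ ν)) G μ ∂P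
      = ∫⁻ μ, d⁻¹ * ∫⁻ y, g μ y ∂(κ μ) ∂P := lintegral_congr fun μ => hstep μ
    _ = ∫⁻ μ, d⁻¹ * ∫⁻ y, g μ y ∂μ ∂P := by
        refine lintegral_congr_ae ?_
        filter_upwards [hlf] with μ hμ
        rw [hκid μ hμ]
    _ = d⁻¹ * ∫⁻ μ, ∫⁻ y, g μ y ∂μ ∂P :=
        lintegral_const_mul' _ _ (ENNReal.inv_ne_top.2 hd0)
    _ = d⁻¹ * ∫⁻ μ, ∫⁻ y, g (Measure.map (fun z => z - y) μ) (-y) ∂μ ∂P := by rw [hP g hg]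
    _ = d⁻¹ * ∫⁻ μ, G μ * d ∂P := by
        congr 1
        refine lintegral_congr_ae ?_
        filter_upwards [hlf, hdeg] with μ hμ hμd
        rw [hrec μ hμ, hμd]
    _ = d⁻¹ * ((∫⁻ μ, G μ ∂P) * d) := by rw [lintegral_mul_const d hG]
    _ = ∫⁻ μ, G μ ∂P := by
        rw [mul_comm (∫⁻ μ, G μ ∂P) d, ← mul_assoc, ENNReal.inv_mul_cancel hd0 hdtop, one_mul]

/-- `n`-STEP TRANSPORT, kernel version: `∫⁻ step^n G ∂P = ∫⁻ G ∂P`. -/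
theorem lintegral_iterate_rootWalkStepK {P : Measure (Measure E)} (hP : IsPointStationaryLaw P)
    (hlf : ∀ᵐ μ ∂P, ∀ n : ℕ, μ ((fun z : E => ⌊‖z‖⌋₊) ⁻¹' {n}) < ∞)
    (κ : Kernel (Measure E) E) [IsSFiniteKernel κ]
    (hκid : ∀ μ : Measure E, (∀ n : ℕ, μ ((fun z : E => ⌊‖z‖⌋₊) ⁻¹' {n}) < ∞) → κ μ = μ)
    {B : Set E} (hBm : MeasurableSet B) (hBsymm : ∀ y : E, -y ∈ B ↔ y ∈ B)
    {d : ℝ≥0∞} (hd0 : d ≠ 0) (hdtop : d ≠ ⊤) (hdeg : ∀ᵐ μ ∂P, μ B = d) :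
    ∀ (n : ℕ) {G : Measure E → ℝ≥0∞}, Measurable G →
      ∫⁻ μ, ((fun (G : Measure E → ℝ≥0∞) (ν : Measure E) =>
      d⁻¹ * ∫⁻ y, B.indicator (fun y => G (Measure.map (fun z => z - y) (κ ν))) y ∂(κ ν))^[n] G) μ ∂P = ∫⁻ μ, G μ ∂P := by
  intro n
  induction n with
  | zero => intro G _; rfl
  | succ n ih =>
    intro G hG
    rw [show ((fun (G : Measure E → ℝ≥0∞) (ν : Measure E) =>
      d⁻¹ * ∫⁻ y, B.indicator (fun y => G (Measure.map (fun z => z - y) (κ ν))) y ∂(κ ν))^[n + 1] G) = ((fun (G : Measure E → ℝ≥0∞) (ν : Measure E) =>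
      d⁻¹ * ∫⁻ y, B.indicator (fun y => G (Measure.map (fun z => z - y) (κ ν))) y ∂(κ ν))^[n]
        ((fun (G : Measure E → ℝ≥0∞) (ν : Measure E) =>
      d⁻¹ * ∫⁻ y, B.indicator (fun y => G (Measure.map (fun z => z - y) (κ ν))) y ∂(κ ν)) G)) from Function.iterate_succ_apply _ _ _]
    rw [ih (measurable_rootWalkStepK κ hBm _ hG)]
    exact lintegral_rootWalkStepK hP hlf κ hκid hBm hBsymm hd0 hdtop hdeg hG

/-- **Bond random walk transport** («SymmetricBondWalkTransport», `ℝ≥0∞` form). Let `P` be a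
point-stationary law (Mecke identity) carried by locally finite configurations, `B` a symmetric
measurable bond set in which the root has a.s. exactly `d ∈ (0, ∞)` neighbours, and
`F : Measure E → ℝ≥0∞` measurable. Then for every `n`, the `n`-step bond-walk average of
`y ↦ F (θ_y μ)` started at the root has `P`-mean `∫⁻ F ∂P`:
`∫⁻ μ, (W_μ^n (y ↦ F (θ_y μ)))(0) ∂P = ∫⁻ μ, F μ ∂P` with `(W_μ h)(x) = d⁻¹ ∫⁻ y, 1_B (y - x) h y ∂μ`.
[AldousLyons2007, §4 Thm 4.1 (SRW-stationarity of unimodular regular graphs), point-process form] -/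
theorem lintegral_confWalk_iterate {P : Measure (Measure E)} (hP : IsPointStationaryLaw P)
    (hlf : ∀ᵐ μ ∂P, ∀ n : ℕ, μ ((fun z : E => ⌊‖z‖⌋₊) ⁻¹' {n}) < ∞)
    {B : Set E} (hBm : MeasurableSet B) (hBsymm : ∀ y : E, -y ∈ B ↔ y ∈ B)
    {d : ℝ≥0∞} (hd0 : d ≠ 0) (hdtop : d ≠ ⊤) (hdeg : ∀ᵐ μ ∂P, μ B = d)
    {F : Measure E → ℝ≥0∞} (hF : Measurable F) (n : ℕ) :
    ∫⁻ μ, ((fun (h : E → ℝ≥0∞) (x : E) => d⁻¹ * ∫⁻ y, ((fun y => y - x) ⁻¹' B).indicator h y ∂μ)^[n] (fun y => F (Measure.map (fun z => z - y) μ))) 0 ∂P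
      = ∫⁻ μ, F μ ∂P := by
  obtain ⟨κ, hκ, hκid⟩ := exists_isSFiniteKernel_apply_eq_self
    (fun n : ℕ => (fun z : E => ⌊‖z‖⌋₊) ⁻¹' {n}) measurableSet_floorNorm_preimage
    (fun i j hij => Set.disjoint_iff.2 fun z hz => hij (hz.1.symm.trans hz.2))
    (fun z => ⟨⌊‖z‖⌋₊, rfl⟩)
  haveI := hκ
  calc ∫⁻ μ, ((fun (h : E → ℝ≥0∞) (x : E) => d⁻¹ * ∫⁻ y, ((fun y => y - x) ⁻¹' B).indicator h y ∂μ)^[n] (fun y => F (Measure.map (fun z => z - y) μ))) 0 ∂P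
      = ∫⁻ μ, ((fun (G : Measure E → ℝ≥0∞) (ν : Measure E) =>
      d⁻¹ * ∫⁻ y, B.indicator (fun y => G (Measure.map (fun z => z - y) ν)) y ∂ν)^[n] F) μ ∂P :=
        lintegral_congr fun μ => (iterate_rootWalkStep_eq_confWalk B d⁻¹ F μ n).symm
    _ = ∫⁻ μ, ((fun (G : Measure E → ℝ≥0∞) (ν : Measure E) =>
      d⁻¹ * ∫⁻ y, B.indicator (fun y => G (Measure.map (fun z => z - y) (κ ν))) y ∂(κ ν))^[n] F) μ ∂P := by
        refine lintegral_congr_ae ?_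
        filter_upwards [hlf] with μ hμ
        exact (iterate_rootWalkStepK_eq κ hκid B d⁻¹ F n μ hμ).symm
    _ = ∫⁻ μ, F μ ∂P :=
        lintegral_iterate_rootWalkStepK hP hlf κ hκid hBm hBsymm hd0 hdtop hdeg n hF

/-- The same identity for the ROOT-FUNCTIONAL walk: `∫⁻ step^n F ∂P = ∫⁻ F ∂P`. -/
theorem lintegral_iterate_rootWalkStep {P : Measure (Measure E)} (hP : IsPointStationaryLaw P)
    (hlf : ∀ᵐ μ ∂P, ∀ n : ℕ, μ ((fun z : E => ⌊‖z‖⌋₊) ⁻¹' {n}) < ∞)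
    {B : Set E} (hBm : MeasurableSet B) (hBsymm : ∀ y : E, -y ∈ B ↔ y ∈ B)
    {d : ℝ≥0∞} (hd0 : d ≠ 0) (hdtop : d ≠ ⊤) (hdeg : ∀ᵐ μ ∂P, μ B = d)
    {F : Measure E → ℝ≥0∞} (hF : Measurable F) (n : ℕ) :
    ∫⁻ μ, ((fun (G : Measure E → ℝ≥0∞) (ν : Measure E) =>
      d⁻¹ * ∫⁻ y, B.indicator (fun y => G (Measure.map (fun z => z - y) ν)) y ∂ν)^[n] F) μ ∂P = ∫⁻ μ, F μ ∂P := by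
  rw [← lintegral_confWalk_iterate hP hlf hBm hBsymm hd0 hdtop hdeg hF n]
  exact lintegral_congr fun μ => iterate_rootWalkStep_eq_confWalk B d⁻¹ F μ n

end Summit.AtomisticToContinuum.Crystallization.Theorems.ChartedPlanarOrderBondWalkTransport
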